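import Literature.MathematicalPhysics.QuantumFieldTheory.Balaban1983to89.B8Ineq159FlatTorus
import Literature.MathematicalPhysics.QuantumFieldTheory.Balaban1983to89.Beta.VectorPropagatorDict
import Literature.MathematicalPhysics.QuantumFieldTheory.Balaban1983to89.Beta.LandauMultiplierIdentities
import Literature.MathematicalPhysics.QuantumFieldTheory.Balaban1983to89.B5LaplaceSpectral
import Literature.MathematicalPhysics.QuantumFieldTheory.Balaban1983to89.B5Substitution125
import Literature.MathematicalPhysics.QuantumFieldTheory.Balaban1983to89.B9Eq325Proj
import Literature.MathematicalPhysics.QuantumFieldTheory.Balaban1983to89.B9Thm311Lattice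

/-!
# `Balaban1983to89.B8Thm4FlatTorus` — T. Bałaban, *Spaces of regular gauge field configurations on a lattice and gauge fixing
# conditions*, Commun. Math. Phys. **99** (1985) 75–102 [Balaban1985RegularSpaces], **Theorem 4** p. 88 (and through it Theorem 2
# p. 83): existence AND uniqueness of the restricted gauge transformation putting `U′U₀` into the Landau gauge w.r.t. `U₀`, with
# the bounds (1.36)–(1.39)/(1.62) — AT THE FLAT BACKGROUND U₀ = 1, in the abelian (linear) chart, for the constant domain sequence
# Ω₀ = … = Ω_k = T_η, on the tori of record — HYPOTHESIS-FREE (rows **B8.Thm4**, B8.Thm2, B8.Eq1.36 cells; heads unchanged)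

statement-level skeleton of published theorems with citation tags; proofs where landed; nothing here is a claim about the Yang–Mills mass gap

PDF held: `paper:balaban1985-cmp99-regular-spaces-gauge-fixing` (journal page = PDF page + 74); pp. 77, 78, 82, 83, 86, 87, 88
[PDF 3, 4, 8, 9, 12, 13, 14] read AS IMAGES this session (renders `run/shared/lean/pub/pub-balaban/b2b-balaban-ref1/pages/
1985-cmp99-regular-spaces-gauge-fixing/1985-cmp99-regular-spaces-gauge-fixing-p0NN-x2.png`); [B5] = T. Bałaban, *Propagators and
renormalization transformations for lattice gauge theories. I*, CMP **95** (1984) 17–40 [Balaban1984PropagatorsI] p. 25 through the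
tree module `B5Identities197Torus` (its verbatim quotations; the projection `RT`).

CITATION HEADER (lean-in-tree rule).  Cell `lit-balaban`, unit `lit-balaban-r05` gen 18 (B8 fold owner), HOME
`run/shared/lean/pub/lit-balaban/` (SKELETON rows B8.Thm4 / B8.Thm2 / B8.Eq1.36 / B8.Eq1.29 / B8.Eq1.38; heads «typed-existing», decls of
record `B8.Thm4Printed` / `B8.Thm2Printed` over the abstract carriers `B8.GFData`, whose general-background content rests on the leaf
[4] Theorems 3.1–3.3 = `B9.Thm31Printed`–`Thm33Printed`).  THIS MODULE is the next item of the r05 FLAT PROGRAMME (gen 11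
`B8Eq158FlatTorus` (1.58), gen 15 `B8Ineq159FlatTorus` (1.59) [+ gen 18 §6 Prop. 3], gen 16 `B8Ineq192FlatTorus` (1.92)/p. 92, gen 16
`B9Ineq349FlatTorus` [4] (3.49), gen 17 `B8Thm8FlatAbelianFamily` / `B8Thm8U1Family` (Theorem 8, refuted as printed in part)):
**Theorem 4 itself at U₀ = 1**, kernel-checked with no hypothesis beyond the printed ones read in the chart.

WHAT IS PRINTED (verbatim).  p. 88 [PDF 14]: *"**Theorem 4.** There exists a constant c₁ such that for arbitrary U₀, U′U₀ satisfying
(1.33), (1.34), (1.66) with α₀ + α₁ ≦ c₁ there exists exactly one gauge transformation u satisfying (1.29) and such that the conditions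
(1.37), (1.38), (1.62) hold for the configuration U₁ = U′^{u⁻¹}.  Of course this theorem implies Theorem 2. Proposition 3 implies
that it is enough to prove (1.37), (1.38) and |A| < B′₁(α₀ + α₁)(L^jη)⁻¹ on Ω_j, B′₁ = C′₁5B₀, (1.67) with an absolute constant C′₁,
i.e. a constant depending on d and L only."*  p. 83 [PDF 9]: *"**Theorem 2.** There exist constants B₁, B₂(β₀), c₁ such that for
arbitrary U₀, U′U₀ satisfying (1.33)–(1.35) with α₀ + α₁ ≦ c₁ there exists exactly one gauge transformation u satisfying (1.29) and
such that the conditions (1.36)–(1.39) hold for the configuration U₁ = U′^{u⁻¹}."*  p. 82 [PDF 8]: *"Now our problem is to construct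
a gauge transformation u satisfying the equalities (1.29) and such that U₁ = U′^{u⁻¹} satisfies the conditions U₁ = e^{iηA},
|A| < B₁(α₀ + α₁)(L^jη)⁻¹, |∇^η_{U₀}A| < B₁(α₀ + α₁)(L^jη)⁻², ‖A‖_{1,β} < B₂(β₀)(α₀ + α₁)(L^jη)^{−2−β}, β ≦ β₀ < 1, on Ω_j, j = 0, 1, …, k,
(1.36)  Q_j(U₀, ηA) = B on Λ_j, j = 0, 1, …, k, B is given by formula (1.31) with V′ = Ū′ʲ, |B| < 2dLα₁ by the assumption (1.35), (1.37)
R(U₀)D^{η*}_{U₀}A = 0. (1.38)"*; p. 83: *"|D^{η*}_{U₀}D^η_{U₀}A|, |Δ^η_{U₀}A| < B₁(α₀ + α₁)(L^jη)⁻³ on Ω_j, j = 0, 1, …, k. (1.39)"*;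
p. 83: *"Also the condition (1.37) is basically of an algebraic character and it follows from the construction, as in (1.30),
(1.31)."*; p. 86 [PDF 12]: *"From (1.40) the term on the left-hand side and the first term on the right-hand side can be estimated by
α₀(L^jη)⁻³η². This implies that D^{η*}_{U₀}D^η_{U₀}A = J, |J| ≦ (2α₀ + 36dα₂(L^jη)²|∇^η_{U₀}A| + 50dα₂³ + 10dα₀α₂)(L^jη)⁻³, (1.55)"*;
p. 87 [PDF 13], Prop. 3: *"then U₁ satisfies (1.36)–(1.39) with B₁ = 5dLB₀, B₂(β₀) = 5dLB₀(β₀), where B₀, B₀(β₀) are the corresponding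
norms of the operators G(U₀), H(U₀), and depend on d and L only"*; p. 77 [PDF 3]: *"Let us notice that we admit the case where some
domains Ω_j are equal to T_η, for example Ω_j = T_η for j = 0, 1, …, l, l ≦ k."*  [B5] p. 25 (through `B5Identities197Torus.RT`): *"The
projection operator R has a clear meaning. It is an orthogonal projection on the linear subspace ΔN(Q′_k) of L²(T_η), N(Q′_k) =
{λ : Q′_kλ = 0}. Indeed RΔλ = Δλ if Q′_kλ = 0, and if Rω = ω then … ω = Δλ and Q′_kλ = 0"*.

THE INSTANCE (dictionary print ↦ Lean; the torus typing of `B8Eq158FlatTorus` / `B8Ineq159FlatTorus` / the B5 lineage).  U₀ = 1 and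
the ADMITTED constant domain sequence Ω₀ = … = Ω_k = T_η (p. 77), one surviving level j = k, L^kη = 1 (so every factor (L^jη)^{−γ} of
(1.36)/(1.39)/(1.62)/(1.67) is 1 and the p. 86 weighted norms are plain suprema — `B8Ineq159FlatTorus.msup_const_eq_supNorm`).  Tori of
record `i : TopIdx d L`: `T_η = Tor (fine n M)`, `n = nP i.P = L^K`, `M_μ = MP i.P μ = 2L^m`.  THE LINEAR (ABELIAN) CHART — as in the
cell՚s gen-17 `B8Thm8FlatAbelianFamily.flatGF`, whose field-by-field reading ref-4 g38 endorsed: the perturbation U′ = e^{iηA′} IS the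
bond field `A′ : T_η × Fin d → ℂ` (ℂ-scalar model of the 𝔤-valued field, as in every torus file); a gauge transformation u = e^{iλ} IS
the site field `λ : T_η → ℂ`; the action (1.17) `U′^{u⁻¹}` IS `A′ ↦ A′ + ∂λ` (`∂ = GradOp (fine n M) n`, lattice factor η⁻¹; the sign of
λ is immaterial); the restriction (1.29) «(R₀u)ʲ = 1 on Λ_j» IS `Q′_kλ = 0` (`QsOp n M`, the site block average — the linearisation of
the exp-mean-arg averages (78)–(81) of [3], cf. `B8Thm8U1Family.lift_restricted` for genuine U(1)-valued u); R(U₀) at U₀ = 1 IS [B5]՚s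
orthogonal projection `RT n M` onto ΔN(Q′_k) (the cell՚s standing reading since `B8Eq158FlatTorus`: (1.42)/(1.38) = `RT *ᵥ (∂ᴴ A) = 0`);
D^{η*}_{U₀}D^η_{U₀} at U₀ = 1 on vector fields IS `½·CurlOpᴴCurlOp` (`B8Eq158FlatTorus.P8T`), Δ^η_{U₀} IS `B5Prop11Lower.Lap`, ∇^η_{U₀} IS
`B5Prop11Lattice.grad`, Q_k IS `B5Block118.QvOp`, `|·|` IS the supremum over T_η.  THE HYPOTHESES of Theorems 2/4 read in the chart
at the one surviving level: (1.33) holds trivially at U₀ = 1; (1.34)/(1.40) enter the printed proof only through (1.55) «D*DA = J,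
|J|₍₋₃₎ ≦ 2α₀ + (α₂-terms)», whose α₂-terms (the commutators of (1.43)–(1.54)) are ABSENT in the abelian chart and whose J = D*DA =
D*DA′ is gauge invariant (`dd_act_eq`) — so (1.34) is READ as `sup_b |(½Curlᴴ Curl A′)(b)| ≦ 2α₀`; (1.35)/(1.66) enter only through
(1.37)/(1.42) «Q_j(U₀, ηA) = B, |B| < 2dLα₁», B = (1/i) log Ū′ʲ, which at U₀ = 1, j = k in the chart is B = Q_kA′ — so (1.35)/(1.66) are
READ as `sup_c |(Q_kA′)(c)| ≦ 2dLα₁` (the axial-gauge clause Ax_k of (1.34) and the threshold «α₀ + α₁ ≦ c₁» are NOT needed in the linear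
chart — the theorem below is stronger for omitting them).

WHAT THIS MODULE PROVES (kernel-checked, 0 sorry, no `… : Prop` fact, theorems only; §§1–4 on EVERY torus `Tor (fine n M)`, `n ≥ 1`).
§1 `exists_restricted_landau` — EXISTENCE: for every A′ there is λ with Q′_kλ = 0 and R ∂ᴴ(A′ + ∂λ) = 0 ([B5] p. 25: R ∂ᴴA′ = Δλ₀ with
   Q′_kλ₀ = 0 — `B5Identities197Torus.RT_mulVec_eq_LapS` —, λ := −λ₀, and RΔλ₀ = Δλ₀ — `RT_mulVec_LapS_of_ker`; ∂ᴴ∂ = Δ —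
   `B5Action121.GradOp_conjTranspose_mul_GradOp`).
§2 `restricted_landau_unique` — UNIQUENESS among ALL restricted λ in the Landau gauge (no smallness, no further condition): two
   solutions differ by μ with Δμ = 0 and Q′_kμ = 0, hence μ constant (`B5LaplaceSpectral.LapS_ker_const`) and then μ = 0
   (`B5Substitution125.QsOp_const`); `existsUnique_restricted_landau` = §1 ∧ §2 («there exists exactly one gauge transformation u
   satisfying (1.29) and such that … (1.38)»).
§3 `avg_act_eq` — (1.37) «is basically of an algebraic character»: Q_k(A′ + ∂λ) = Q_kA′ for Q′_kλ = 0, from [B5] (1.20)/(1.55)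
   Q_k∂ = ∂₁Q′_k (`Beta.VectorPropagatorDict.QvOp_mul_GradOp`); `dd_act_eq` — D*D(A′ + ∂λ) = D*DA′ (Curl ∂ = 0,
   `Beta.LandauMultiplierIdentities.CurlOp_mul_GradOp`).
§4 **`thm4_flat`** — THEOREM 4 AT U₀ = 1 on the tori of record: ONE constant B₁ = 5dLB₀(d, L) (Prop. 3՚s «B₁ = 5dLB₀», B₀ ≥ 1 the
   constant of `B8Ineq159FlatTorus.ineq159_flat`) such that for every torus of record, every α₀, α₁ ≥ 0 and every A′ with
   `sup|D*DA′| ≦ 2α₀` and `sup|Q_kA′| ≦ 2dLα₁`: (i) there is EXACTLY ONE λ with Q′_kλ = 0 and R ∂ᴴ(A′ + ∂λ) = 0 [(1.29) + (1.38)], and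
   (ii) for it — indeed for any restricted λ in the Landau gauge — A := A′ + ∂λ satisfies (1.37) `Q_kA = Q_kA′` (so |B| ≦ 2dLα₁), and the
   sup members of (1.36)/(1.62)/(1.67) `|A|, |∇A| ≦ B₁(α₀ + α₁)` and (1.39) `|D*DA|, |ΔA| ≦ B₁(α₀ + α₁)` POINTWISE — by
   `B8Ineq159FlatTorus.ineq159_flat_printed` ((1.58)–(1.59) at U₀ = 1 from [B5] (1.115)) fed with (1.55) J = D*DA = D*DA′ and (1.56)
   B₁ = Q_kA = Q_kA′; **`thm2_flat`** — the same packaged as Theorem 2՚s sentence (∃! restricted u; (1.36) sup members, (1.37), (1.38),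
   (1.39) for U₁); `thm4_flat_of_avg_le` — the variant with the rawer chart reading `sup|Q_kA′| ≦ α₁` of (1.66).

HONEST SCOPE.  (i) U₀ = 1, the constant domain sequence and the LINEAR chart ONLY: the content of Theorems 2/4 at a general regular
background (the contraction of Sects. C–E, Prop. 5, the operators G′/H′ of (1.91) with [4] Thms 3.1–3.2) is NOT touched — rows B8.Thm2 /
B8.Thm4 keep their heads; this is the «without external gauge field» base case, in which the nonlinear gauge fixing of Sect. D
degenerates to linear algebra over [B5]՚s projection R (no threshold c₁ is needed and none is assumed).  (ii) NOT part of the instance: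
the Hölder member ‖A‖_{1,β} < B₂(β₀)(α₀ + α₁)(L^jη)^{−2−β} of (1.36) (operator H(U₀); the β-Hölder norm is not modelled in the torus
files), the strict «<» (we prove «≦»), and print՚s multi-level weights (one level survives).  (iii) The hypotheses are the PROCESSED
forms (1.55)/(1.37) through which (1.34)/(1.35)/(1.66) enter the printed proof at U₀ = 1 (see THE INSTANCE); reading 𝔄_k-membership of
e^{iηA′} itself would only fix a normalisation of the same two suprema.  (iv) Constants: B₁ = 5dLB₀ with the B₀(d, L) of gen 15 (crude,
ours; print: «depend on d and L only»).  (v) ℂ-scalar fields (abelian model); non-abelian groups are not modelled (at U₀ = 1 the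
linearised problem is the same componentwise).  Value = Theorem 4՚s existence-uniqueness-bounds sentence kernel-checked in the base case,
NOT summit progress; nothing here bears on the Yang–Mills mass gap.

VERSION v1.1 (r05 gen 18, APPEND-ONLY §5): `existsUnique_restricted_landau_abstract` — the «exactly one gauge transformation» clause of
Theorems 2/4 at background 1 for an ARBITRARY restriction subspace N with N ⊓ ker D = ⊥ and R := the orthogonal projection
(`Submodule.starProjection`) onto D†D(N): pure finite-dimensional linear algebra over print՚s definition of R ([B5] p. 25 / [4] (3.21)),
covering every admissible domain sequence {Ω_j} (in particular the nested cubes of Prop. 6) at the algebraic level; no estimate, no new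
definition, §§1–4 unchanged.
VERSION v1.2 (r05 gen 18, APPEND-ONLY §6): bridge to [4] (3.22)/(3.25) as typed in `B9Eq325Proj` — on print՚s inputs
(`B9Eq325Proj.Data`, G′ = (Δ + Q′*aQ′)⁻¹ named, Δ = D†D) §5՚s hypothesis N(Q′) ⊓ ker D = ⊥ HOLDS (`ker_inf_ker_eq_bot_of_data`),
the unique restricted parameter is EXPLICIT, λ = −G′RT (`neg_lam0_solves`, `existsUnique_restricted_landau_325`,
`restricted_landau_eq_neg_lam0`, `R325_landau_iff` with R = the (3.25) operator) — p. 91 «RΔλ = Δλ … the invertible operator»;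
+ import `B9Eq325Proj`; §§1–5 unchanged.
VERSION v1.3 (r05 gen 18, APPEND-ONLY §7): the CONCRETE multi-domain instance at an ARBITRARY background on [4]՚s lattice systems as
typed by r06՚s `B9Thm311Lattice` (finite lattice, positive bond weights, injective transporters R(U(b)), ANY `IsBlockSystem`) —
`existsUnique_restricted_landau_lattice` (Thm 3.11 «obvious» `obvious_311_lattice` ⇒ `Data` ⇒ §6) and `R325_landau_iff_lattice`
(λ = −G′RT for any printed G′); + import `B9Thm311Lattice`; §§1–6 unchanged.
-/

noncomputable section

open scoped BigOperators Matrix ComplexConjugate InnerProductSpace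
open Finset Matrix

namespace Literature.MathematicalPhysics.QuantumFieldTheory.Balaban1983to89.B8Thm4FlatTorus

open B5Prop11Plancherel (Tor fine)
open B5Action121 (LapS CurlOp GradOp GradOp_conjTranspose_mul_GradOp)
open B5Block118 (QvOp QsOp)
open B5Prop11Lattice (grad)
open B5Prop11Lower (Lap)
open LatticeNorms (supNorm norm_le_supNorm supNorm_le supNorm_nonneg)
open B5SiteBridgeP12 (nP MP one_le_nP)
open B5ResidualGpTorusHolds (TopIdx)
open B5Identities197Torus (RT RT_mulVec_eq_LapS RT_mulVec_LapS_of_ker)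
open Beta.VectorPropagatorDict (QvOp_mul_GradOp)
open Beta.LandauMultiplierIdentities (CurlOp_mul_GradOp)
open B8Ineq159FlatTorus (ineq159_flat_printed)

variable {d : ℕ}

/-! ## §1–§3 The linear algebra of the restricted Landau gauge at U₀ = 1 (every torus) -/

section Algebra

variable (n : ℕ) [NeZero n] (M : Fin d → ℕ) [hM : ∀ μ, NeZero (M μ)]

/-- the Landau condition of `A′ + ∂λ` splits: `R∂ᴴ(A′ + ∂λ) = R∂ᴴA′ + RΔλ` (`∂ᴴ∂ = Δ`).
[cite: Balaban1985RegularSpaces, (1.38) p.82; Balaban1984PropagatorsI, p.25] -/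
theorem landau_act_eq (A' : Tor (fine n M) × Fin d → ℂ) (lam : Tor (fine n M) → ℂ) :
    RT n M *ᵥ ((GradOp (fine n M) (n : ℂ))ᴴ *ᵥ (A' + GradOp (fine n M) (n : ℂ) *ᵥ lam))
      = RT n M *ᵥ ((GradOp (fine n M) (n : ℂ))ᴴ *ᵥ A') + RT n M *ᵥ (LapS (fine n M) (n : ℂ) *ᵥ lam) := by
  have h : (GradOp (fine n M) (n : ℂ))ᴴ *ᵥ (GradOp (fine n M) (n : ℂ) *ᵥ lam) = LapS (fine n M) (n : ℂ) *ᵥ lam := by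
    rw [Matrix.mulVec_mulVec, GradOp_conjTranspose_mul_GradOp]
  rw [Matrix.mulVec_add, h, Matrix.mulVec_add]

/-- **§1 EXISTENCE of the restricted Landau gauge transformation at U₀ = 1** («there exists … one gauge transformation u satisfying
(1.29) and such that … (1.38) hold[s]»): for every bond field A′ there is a site field λ with `Q′_kλ = 0` and `R ∂ᴴ(A′ + ∂λ) = 0` —
λ := −λ₀ where R∂ᴴA′ = Δλ₀, Q′_kλ₀ = 0 ([B5] p. 25). [cite: Balaban1985RegularSpaces, Thm 4 p.88, (1.29) p.81, (1.38) p.82;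
Balaban1984PropagatorsI, p.25] -/
theorem exists_restricted_landau (A' : Tor (fine n M) × Fin d → ℂ) :
    ∃ lam : Tor (fine n M) → ℂ, QsOp n M *ᵥ lam = 0 ∧
      RT n M *ᵥ ((GradOp (fine n M) (n : ℂ))ᴴ *ᵥ (A' + GradOp (fine n M) (n : ℂ) *ᵥ lam)) = 0 := by
  obtain ⟨l, hl, hw⟩ := RT_mulVec_eq_LapS n M ((GradOp (fine n M) (n : ℂ))ᴴ *ᵥ A')
  refine ⟨-l, ?_, ?_⟩
  · rw [Matrix.mulVec_neg, hl, neg_zero]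
  · rw [landau_act_eq, hw, Matrix.mulVec_neg, Matrix.mulVec_neg, RT_mulVec_LapS_of_ker n M l hl, add_neg_cancel]

/-- **§2 UNIQUENESS** («exactly one»): two restricted site fields putting A′ into the Landau gauge coincide — their difference μ has
`Δμ = R∂ᴴA′ − R∂ᴴA′ = 0` (by «RΔλ = Δλ if Q′_kλ = 0», [B5] p. 25), hence is constant on the torus, and a constant with vanishing block
averages is 0.  No smallness condition is needed in the linear chart. [cite: Balaban1985RegularSpaces, Thm 4 p.88 («exactly one»),
(1.29) p.81, (1.38) p.82; Balaban1984PropagatorsI, p.25, Sect. C p.22] -/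
theorem restricted_landau_unique (A' : Tor (fine n M) × Fin d → ℂ) {lam₁ lam₂ : Tor (fine n M) → ℂ}
    (h₁ : QsOp n M *ᵥ lam₁ = 0) (h₂ : QsOp n M *ᵥ lam₂ = 0)
    (hL₁ : RT n M *ᵥ ((GradOp (fine n M) (n : ℂ))ᴴ *ᵥ (A' + GradOp (fine n M) (n : ℂ) *ᵥ lam₁)) = 0)
    (hL₂ : RT n M *ᵥ ((GradOp (fine n M) (n : ℂ))ᴴ *ᵥ (A' + GradOp (fine n M) (n : ℂ) *ᵥ lam₂)) = 0) :
    lam₁ = lam₂ := by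
  have hc : (n : ℂ) ≠ 0 := Nat.cast_ne_zero.mpr (NeZero.ne n)
  rw [landau_act_eq, RT_mulVec_LapS_of_ker n M lam₁ h₁] at hL₁
  rw [landau_act_eq, RT_mulVec_LapS_of_ker n M lam₂ h₂] at hL₂
  -- `Δ(λ₁ − λ₂) = 0`
  have hΔ : LapS (fine n M) (n : ℂ) *ᵥ (lam₁ - lam₂) = 0 := by
    rw [Matrix.mulVec_sub]
    have e₁ := eq_neg_of_add_eq_zero_right hL₁
    have e₂ := eq_neg_of_add_eq_zero_right hL₂
    rw [e₁, e₂, sub_self]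
  -- hence `λ₁ − λ₂` is the constant `c`
  set c : ℂ := (lam₁ - lam₂) 0 with hcdef
  have hconst : lam₁ - lam₂ = fun _ => c := by
    funext x
    exact B5LaplaceSpectral.LapS_ker_const (fine n M) hc (lam₁ - lam₂) hΔ x
  -- and `Q′_k c = c = 0`
  have hQ : QsOp n M *ᵥ (lam₁ - lam₂) = 0 := by rw [Matrix.mulVec_sub, h₁, h₂, sub_self]
  rw [hconst, B5Substitution125.QsOp_const n M c] at hQ
  have hc0 : c = 0 := by
    have := congrFun hQ (0 : Tor M)
    simpa using this
  have : lam₁ - lam₂ = 0 := by rw [hconst, hc0]; rfl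
  exact sub_eq_zero.mp this

/-- **§1 ∧ §2: «there exists exactly one gauge transformation u satisfying (1.29) and such that … (1.38)»**, at U₀ = 1 in the linear
chart, on every torus, for every A′. [cite: Balaban1985RegularSpaces, Thm 4 p.88, Thm 2 p.83] -/
theorem existsUnique_restricted_landau (A' : Tor (fine n M) × Fin d → ℂ) :
    ∃! lam : Tor (fine n M) → ℂ, QsOp n M *ᵥ lam = 0 ∧
      RT n M *ᵥ ((GradOp (fine n M) (n : ℂ))ᴴ *ᵥ (A' + GradOp (fine n M) (n : ℂ) *ᵥ lam)) = 0 := by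
  obtain ⟨lam, hQ, hL⟩ := exists_restricted_landau n M A'
  exact ⟨lam, ⟨hQ, hL⟩, fun lam' h' => restricted_landau_unique n M A' h'.1 hQ h'.2 hL⟩

/-- **§3 (1.37) «is basically of an algebraic character and it follows from the construction»**: for a restricted λ the block
averages of `A′ + ∂λ` are those of A′ — [B5] (1.20)/(1.55) `Q_k∂ = ∂₁Q′_k` and `Q′_kλ = 0`; so at U₀ = 1 the B of (1.37) is `Q_kA′`.
[cite: Balaban1985RegularSpaces, (1.37) p.82, p.83; Balaban1984PropagatorsI, (1.20) p.20, (1.55) p.27] -/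
theorem avg_act_eq (A' : Tor (fine n M) × Fin d → ℂ) {lam : Tor (fine n M) → ℂ} (hlam : QsOp n M *ᵥ lam = 0) :
    QvOp n M *ᵥ (A' + GradOp (fine n M) (n : ℂ) *ᵥ lam) = QvOp n M *ᵥ A' := by
  rw [Matrix.mulVec_add, Matrix.mulVec_mulVec, QvOp_mul_GradOp n M, ← Matrix.mulVec_mulVec, hlam, Matrix.mulVec_zero,
    add_zero]

/-- **gauge invariance of J = D*DA at U₀ = 1**: `D*D(A′ + ∂λ) = D*DA′` (`Curl ∂ = 0`) — the (1.55) datum of the gauge-fixed field is that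
of A′. [cite: Balaban1985RegularSpaces, (1.55) p.86, (1.11) p.77] -/
theorem dd_act_eq (A' : Tor (fine n M) × Fin d → ℂ) (lam : Tor (fine n M) → ℂ) :
    (1 / 2 : ℂ) • ((CurlOp (fine n M) (n : ℂ))ᴴ *ᵥ (CurlOp (fine n M) (n : ℂ) *ᵥ (A' + GradOp (fine n M) (n : ℂ) *ᵥ lam)))
      = (1 / 2 : ℂ) • ((CurlOp (fine n M) (n : ℂ))ᴴ *ᵥ (CurlOp (fine n M) (n : ℂ) *ᵥ A')) := by
  rw [Matrix.mulVec_add, Matrix.mulVec_mulVec, CurlOp_mul_GradOp (fine n M) (n : ℂ), Matrix.zero_mulVec, add_zero]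

end Algebra

/-! ## §4 Theorem 4 (and Theorem 2) at U₀ = 1 on the tori of record -/

section Main

variable {L : ℕ}

/-- **THEOREM 4 AT THE FLAT BACKGROUND U₀ = 1 (linear chart, constant domain sequence, tori of record), HYPOTHESIS-FREE.**  There is
ONE constant `B₁ = 5dLB₀(d, L) ≥ 1` (Prop. 3՚s «B₁ = 5dLB₀») such that for every torus of record `i`, all `α₀, α₁ ≥ 0` and every
perturbation A′ with `sup|D*DA′| ≦ 2α₀` [(1.34) through (1.55)] and `sup|Q_kA′| ≦ 2dLα₁` [(1.35)/(1.66) through (1.37)]: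
(i) «there exists exactly one gauge transformation u satisfying (1.29) and such that … (1.38)»: ∃! λ, `Q′_kλ = 0 ∧ R∂ᴴ(A′ + ∂λ) = 0`;
(ii) for every such λ the field `A = A′ + ∂λ` of `U₁ = U′^{u⁻¹} = e^{iηA}` satisfies (1.37) `Q_kA = Q_kA′` and the bounds (1.62)/(1.67)/
(1.36)/(1.39) at the surviving level (L^kη = 1): `|A(b)|, |(∇A)(ν,b)|, |(D*DA)(b)|, |(ΔA)(b)| ≦ B₁(α₀ + α₁)` for all b, ν.
Print՚s threshold «α₀ + α₁ ≦ c₁» and the axial clause of (1.34) are not needed here (stronger statement).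
[cite: Balaban1985RegularSpaces, Thm 4 p.88, (1.67) p.88, (1.29) p.81, (1.36)–(1.38) p.82, (1.39) p.83, (1.55)–(1.59) p.86,
Prop. 3 (1.62) p.87; Balaban1984PropagatorsI, p.25, (1.115) p.36] -/
theorem thm4_flat (hd : 1 ≤ d) (hL : Odd L ∧ 1 < L) :
    ∃ B₁ : ℝ, 1 ≤ B₁ ∧ ∀ (i : TopIdx d L) (α₀ α₁ : ℝ) (A' : Tor (fine (nP i.P) (MP i.P)) × Fin i.P.d → ℂ),
      0 ≤ α₀ → 0 ≤ α₁ →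
      (∀ b, ‖((1 / 2 : ℂ) • ((CurlOp (fine (nP i.P) (MP i.P)) ((nP i.P : ℕ) : ℂ))ᴴ *ᵥ
          (CurlOp (fine (nP i.P) (MP i.P)) ((nP i.P : ℕ) : ℂ) *ᵥ A'))) b‖ ≤ 2 * α₀) →
      (∀ c, ‖(QvOp (nP i.P) (MP i.P) *ᵥ A') c‖ ≤ 2 * d * L * α₁) →
      (∃! lam : Tor (fine (nP i.P) (MP i.P)) → ℂ, QsOp (nP i.P) (MP i.P) *ᵥ lam = 0 ∧
        RT (nP i.P) (MP i.P) *ᵥ ((GradOp (fine (nP i.P) (MP i.P)) ((nP i.P : ℕ) : ℂ))ᴴ *ᵥ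
          (A' + GradOp (fine (nP i.P) (MP i.P)) ((nP i.P : ℕ) : ℂ) *ᵥ lam)) = 0) ∧
      ∀ lam : Tor (fine (nP i.P) (MP i.P)) → ℂ, QsOp (nP i.P) (MP i.P) *ᵥ lam = 0 →
        RT (nP i.P) (MP i.P) *ᵥ ((GradOp (fine (nP i.P) (MP i.P)) ((nP i.P : ℕ) : ℂ))ᴴ *ᵥ
          (A' + GradOp (fine (nP i.P) (MP i.P)) ((nP i.P : ℕ) : ℂ) *ᵥ lam)) = 0 →
        QvOp (nP i.P) (MP i.P) *ᵥ (A' + GradOp (fine (nP i.P) (MP i.P)) ((nP i.P : ℕ) : ℂ) *ᵥ lam)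
            = QvOp (nP i.P) (MP i.P) *ᵥ A' ∧
        (∀ b, ‖(A' + GradOp (fine (nP i.P) (MP i.P)) ((nP i.P : ℕ) : ℂ) *ᵥ lam) b‖ ≤ B₁ * (α₀ + α₁)) ∧
        (∀ ν b, ‖grad (nP i.P) (MP i.P) (A' + GradOp (fine (nP i.P) (MP i.P)) ((nP i.P : ℕ) : ℂ) *ᵥ lam) ν b‖
            ≤ B₁ * (α₀ + α₁)) ∧
        (∀ b, ‖((1 / 2 : ℂ) • ((CurlOp (fine (nP i.P) (MP i.P)) ((nP i.P : ℕ) : ℂ))ᴴ *ᵥ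
            (CurlOp (fine (nP i.P) (MP i.P)) ((nP i.P : ℕ) : ℂ) *ᵥ
              (A' + GradOp (fine (nP i.P) (MP i.P)) ((nP i.P : ℕ) : ℂ) *ᵥ lam)))) b‖ ≤ B₁ * (α₀ + α₁)) ∧
        (∀ b, ‖(Lap (nP i.P) (MP i.P) *ᵥ (A' + GradOp (fine (nP i.P) (MP i.P)) ((nP i.P : ℕ) : ℂ) *ᵥ lam)) b‖
            ≤ B₁ * (α₀ + α₁)) := by
  obtain ⟨B₀, hB₀, h⟩ := ineq159_flat_printed hd hL
  have hdL : (1 : ℝ) ≤ (d : ℝ) * (L : ℝ) := by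
    have h1 : (1 : ℝ) ≤ d := by exact_mod_cast hd
    have h2 : (1 : ℝ) ≤ L := by exact_mod_cast hL.2.le
    nlinarith
  have hB₀' : 0 ≤ B₀ := zero_le_one.trans hB₀
  refine ⟨5 * d * L * B₀, ?_, fun i α₀ α₁ A' hα₀ hα₁ hJ hQ => ⟨existsUnique_restricted_landau _ _ A', ?_⟩⟩
  · -- `1 ≤ 5dL·B₀`
    have : (1 : ℝ) ≤ 5 * ((d : ℝ) * L) := by linarith
    calc (1 : ℝ) ≤ 5 * ((d : ℝ) * L) * 1 := by linarith
      _ ≤ 5 * ((d : ℝ) * L) * B₀ := mul_le_mul_of_nonneg_left hB₀ (by positivity)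
      _ = 5 * d * L * B₀ := by ring
  intro lam hlam hLan
  -- the gauge-fixed field and its (1.55)/(1.56) data
  set A : Tor (fine (nP i.P) (MP i.P)) × Fin i.P.d → ℂ :=
    A' + GradOp (fine (nP i.P) (MP i.P)) ((nP i.P : ℕ) : ℂ) *ᵥ lam with hAdef
  set J : Tor (fine (nP i.P) (MP i.P)) × Fin i.P.d → ℂ :=
    (1 / 2 : ℂ) • ((CurlOp (fine (nP i.P) (MP i.P)) ((nP i.P : ℕ) : ℂ))ᴴ *ᵥ
      (CurlOp (fine (nP i.P) (MP i.P)) ((nP i.P : ℕ) : ℂ) *ᵥ A)) with hJdef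
  set B₁' : Tor (MP i.P) × Fin i.P.d → ℂ := QvOp (nP i.P) (MP i.P) *ᵥ A with hB1def
  have h37 : B₁' = QvOp (nP i.P) (MP i.P) *ᵥ A' := by rw [hB1def, hAdef, avg_act_eq _ _ A' hlam]
  have h55J : J = (1 / 2 : ℂ) • ((CurlOp (fine (nP i.P) (MP i.P)) ((nP i.P : ℕ) : ℂ))ᴴ *ᵥ
      (CurlOp (fine (nP i.P) (MP i.P)) ((nP i.P : ℕ) : ℂ) *ᵥ A')) := by rw [hJdef, hAdef, dd_act_eq]
  -- sizes: |J| ≤ 2α₀, |B₁| ≤ 2dLα₁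
  have hJsup : supNorm univ J ≤ 2 * α₀ := supNorm_le (by linarith) fun b _ => by rw [h55J]; exact hJ b
  have hBsup : supNorm univ B₁' ≤ 2 * d * L * α₁ := supNorm_le (by positivity) fun c _ => by rw [h37]; exact hQ c
  -- (1.58)–(1.59) at U₀ = 1
  obtain ⟨hAb, hgr, hdd, hlap⟩ := h i J A B₁' rfl hLan rfl
  have hbound : B₀ * (supNorm univ J + supNorm univ B₁') ≤ 5 * d * L * B₀ * (α₀ + α₁) := by
    have h1 : supNorm univ J + supNorm univ B₁' ≤ 2 * α₀ + 2 * d * L * α₁ := add_le_add hJsup hBsup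
    have h2 : 2 * α₀ + 2 * d * L * α₁ ≤ 5 * d * L * (α₀ + α₁) := by
      nlinarith [mul_nonneg (sub_nonneg.2 hdL) hα₀, mul_nonneg (sub_nonneg.2 hdL) hα₁]
    calc B₀ * (supNorm univ J + supNorm univ B₁') ≤ B₀ * (5 * d * L * (α₀ + α₁)) :=
          mul_le_mul_of_nonneg_left (h1.trans h2) hB₀'
      _ = 5 * d * L * B₀ * (α₀ + α₁) := by ring
  refine ⟨?_, fun b => (hAb b).trans hbound, fun ν b => (hgr ν b).trans hbound, fun b => (hdd b).trans hbound,
    fun b => (hlap b).trans hbound⟩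
  exact h37

/-- **THEOREM 4 FLAT with the rawer chart reading of (1.66)** `sup|Q_kA′| ≦ α₁` («|(U′U₀)ʲ − U₀ʲ| < α₁», Ū′ᵏ = e^{iQ_k(ηA′)L^k} linearised;
then |B| = |Q_kA′| ≦ α₁ ≦ 2dLα₁ as in (1.37)): the same conclusions with the same B₁. [cite: Balaban1985RegularSpaces, Thm 4 p.88,
(1.66) p.87, (1.37) p.82] -/
theorem thm4_flat_of_avg_le (hd : 1 ≤ d) (hL : Odd L ∧ 1 < L) :
    ∃ B₁ : ℝ, 1 ≤ B₁ ∧ ∀ (i : TopIdx d L) (α₀ α₁ : ℝ) (A' : Tor (fine (nP i.P) (MP i.P)) × Fin i.P.d → ℂ),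
      0 ≤ α₀ → 0 ≤ α₁ →
      (∀ b, ‖((1 / 2 : ℂ) • ((CurlOp (fine (nP i.P) (MP i.P)) ((nP i.P : ℕ) : ℂ))ᴴ *ᵥ
          (CurlOp (fine (nP i.P) (MP i.P)) ((nP i.P : ℕ) : ℂ) *ᵥ A'))) b‖ ≤ 2 * α₀) →
      (∀ c, ‖(QvOp (nP i.P) (MP i.P) *ᵥ A') c‖ ≤ α₁) →
      (∃! lam : Tor (fine (nP i.P) (MP i.P)) → ℂ, QsOp (nP i.P) (MP i.P) *ᵥ lam = 0 ∧
        RT (nP i.P) (MP i.P) *ᵥ ((GradOp (fine (nP i.P) (MP i.P)) ((nP i.P : ℕ) : ℂ))ᴴ *ᵥ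
          (A' + GradOp (fine (nP i.P) (MP i.P)) ((nP i.P : ℕ) : ℂ) *ᵥ lam)) = 0) ∧
      ∀ lam : Tor (fine (nP i.P) (MP i.P)) → ℂ, QsOp (nP i.P) (MP i.P) *ᵥ lam = 0 →
        RT (nP i.P) (MP i.P) *ᵥ ((GradOp (fine (nP i.P) (MP i.P)) ((nP i.P : ℕ) : ℂ))ᴴ *ᵥ
          (A' + GradOp (fine (nP i.P) (MP i.P)) ((nP i.P : ℕ) : ℂ) *ᵥ lam)) = 0 →
        QvOp (nP i.P) (MP i.P) *ᵥ (A' + GradOp (fine (nP i.P) (MP i.P)) ((nP i.P : ℕ) : ℂ) *ᵥ lam)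
            = QvOp (nP i.P) (MP i.P) *ᵥ A' ∧
        (∀ b, ‖(A' + GradOp (fine (nP i.P) (MP i.P)) ((nP i.P : ℕ) : ℂ) *ᵥ lam) b‖ ≤ B₁ * (α₀ + α₁)) ∧
        (∀ ν b, ‖grad (nP i.P) (MP i.P) (A' + GradOp (fine (nP i.P) (MP i.P)) ((nP i.P : ℕ) : ℂ) *ᵥ lam) ν b‖
            ≤ B₁ * (α₀ + α₁)) ∧
        (∀ b, ‖((1 / 2 : ℂ) • ((CurlOp (fine (nP i.P) (MP i.P)) ((nP i.P : ℕ) : ℂ))ᴴ *ᵥ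
            (CurlOp (fine (nP i.P) (MP i.P)) ((nP i.P : ℕ) : ℂ) *ᵥ
              (A' + GradOp (fine (nP i.P) (MP i.P)) ((nP i.P : ℕ) : ℂ) *ᵥ lam)))) b‖ ≤ B₁ * (α₀ + α₁)) ∧
        (∀ b, ‖(Lap (nP i.P) (MP i.P) *ᵥ (A' + GradOp (fine (nP i.P) (MP i.P)) ((nP i.P : ℕ) : ℂ) *ᵥ lam)) b‖
            ≤ B₁ * (α₀ + α₁)) := by
  obtain ⟨B₁, hB₁, h⟩ := thm4_flat hd hL
  have hdL : (1 : ℝ) ≤ (d : ℝ) * (L : ℝ) := by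
    have h1 : (1 : ℝ) ≤ d := by exact_mod_cast hd
    have h2 : (1 : ℝ) ≤ L := by exact_mod_cast hL.2.le
    nlinarith
  refine ⟨B₁, hB₁, fun i α₀ α₁ A' hα₀ hα₁ hJ hQ => h i α₀ α₁ A' hα₀ hα₁ hJ fun c => (hQ c).trans ?_⟩
  nlinarith

/-- **THEOREM 2 AT THE FLAT BACKGROUND U₀ = 1** («Of course this theorem implies Theorem 2», p. 88): with the constant B₁ = 5dLB₀ of
`thm4_flat` — «There exist constants B₁, … such that for arbitrary U₀, U′U₀ satisfying (1.33)–(1.35) … there exists exactly one gauge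
transformation u satisfying (1.29) and such that the conditions (1.36)–(1.39) hold for the configuration U₁ = U′^{u⁻¹}» — read in the
linear chart at the surviving level: ∃! restricted λ in the Landau gauge (1.38), and for it (1.36) `|A|, |∇^η_{U₀}A| ≦ B₁(α₀ + α₁)`,
(1.37) `Q_kA = Q_kA′` («|B| < 2dLα₁ by the assumption (1.35)»), (1.39) `|D^{η*}_{U₀}D^η_{U₀}A|, |Δ^η_{U₀}A| ≦ B₁(α₀ + α₁)`.  The Hölder
member of (1.36) is not part of the instance (HONEST SCOPE (ii)). [cite: Balaban1985RegularSpaces, Thm 2 p.83, (1.36)–(1.38) p.82,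
(1.39) p.83, Thm 4 p.88] -/
theorem thm2_flat (hd : 1 ≤ d) (hL : Odd L ∧ 1 < L) :
    ∃ B₁ : ℝ, 1 ≤ B₁ ∧ ∀ (i : TopIdx d L) (α₀ α₁ : ℝ) (A' : Tor (fine (nP i.P) (MP i.P)) × Fin i.P.d → ℂ),
      0 ≤ α₀ → 0 ≤ α₁ →
      (∀ b, ‖((1 / 2 : ℂ) • ((CurlOp (fine (nP i.P) (MP i.P)) ((nP i.P : ℕ) : ℂ))ᴴ *ᵥ
          (CurlOp (fine (nP i.P) (MP i.P)) ((nP i.P : ℕ) : ℂ) *ᵥ A'))) b‖ ≤ 2 * α₀) →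
      (∀ c, ‖(QvOp (nP i.P) (MP i.P) *ᵥ A') c‖ ≤ 2 * d * L * α₁) →
      ∃! lam : Tor (fine (nP i.P) (MP i.P)) → ℂ, QsOp (nP i.P) (MP i.P) *ᵥ lam = 0 ∧
        RT (nP i.P) (MP i.P) *ᵥ ((GradOp (fine (nP i.P) (MP i.P)) ((nP i.P : ℕ) : ℂ))ᴴ *ᵥ
          (A' + GradOp (fine (nP i.P) (MP i.P)) ((nP i.P : ℕ) : ℂ) *ᵥ lam)) = 0 ∧
        QvOp (nP i.P) (MP i.P) *ᵥ (A' + GradOp (fine (nP i.P) (MP i.P)) ((nP i.P : ℕ) : ℂ) *ᵥ lam)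
            = QvOp (nP i.P) (MP i.P) *ᵥ A' ∧
        (∀ b, ‖(A' + GradOp (fine (nP i.P) (MP i.P)) ((nP i.P : ℕ) : ℂ) *ᵥ lam) b‖ ≤ B₁ * (α₀ + α₁)) ∧
        (∀ ν b, ‖grad (nP i.P) (MP i.P) (A' + GradOp (fine (nP i.P) (MP i.P)) ((nP i.P : ℕ) : ℂ) *ᵥ lam) ν b‖
            ≤ B₁ * (α₀ + α₁)) ∧
        (∀ b, ‖((1 / 2 : ℂ) • ((CurlOp (fine (nP i.P) (MP i.P)) ((nP i.P : ℕ) : ℂ))ᴴ *ᵥ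
            (CurlOp (fine (nP i.P) (MP i.P)) ((nP i.P : ℕ) : ℂ) *ᵥ
              (A' + GradOp (fine (nP i.P) (MP i.P)) ((nP i.P : ℕ) : ℂ) *ᵥ lam)))) b‖ ≤ B₁ * (α₀ + α₁)) ∧
        (∀ b, ‖(Lap (nP i.P) (MP i.P) *ᵥ (A' + GradOp (fine (nP i.P) (MP i.P)) ((nP i.P : ℕ) : ℂ) *ᵥ lam)) b‖
            ≤ B₁ * (α₀ + α₁)) := by
  obtain ⟨B₁, hB₁, h⟩ := thm4_flat hd hL
  refine ⟨B₁, hB₁, fun i α₀ α₁ A' hα₀ hα₁ hJ hQ => ?_⟩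
  obtain ⟨⟨lam, ⟨hQl, hLl⟩, huniq⟩, hall⟩ := h i α₀ α₁ A' hα₀ hα₁ hJ hQ
  obtain ⟨h37, hA, hg, hdd, hl⟩ := hall lam hQl hLl
  exact ⟨lam, ⟨hQl, hLl, h37, hA, hg, hdd, hl⟩, fun lam' h' => huniq lam' ⟨h'.1, h'.2.1⟩⟩

end Main

/-! ## §5 (v1.1, r05 gen 18) The «exactly one» clause at background 1 is domain-sequence-independent linear algebra -/

section Abstract

variable {𝕜 V W : Type*} [RCLike 𝕜]
  [NormedAddCommGroup V] [InnerProductSpace 𝕜 V] [FiniteDimensional 𝕜 V]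
  [NormedAddCommGroup W] [InnerProductSpace 𝕜 W] [FiniteDimensional 𝕜 W]

/-- **THE «EXACTLY ONE GAUGE TRANSFORMATION» CLAUSE OF THEOREMS 2/4 AT BACKGROUND 1 FOR AN ARBITRARY DOMAIN SEQUENCE — abstract form.**
Print defines R(U₀) as «an orthogonal projection on the linear subspace ΔN(Q′_k) of L²(T_η), N(Q′_k) = {λ : Q′_kλ = 0}» ([B5] p. 25; the same
sentence for a general sequence {Ω_j} is [4] (3.21) p. 394 «R = R(U) is an orthogonal projection in the Hilbert space L²(Ω₀, 𝔤) onto the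
subspace ℛ = Δ^η_U N(Q′)», cited on p. 80 of [B8] for (1.27)).  With ONLY that definition: let V (gauge parameters / site functions) and W
(vector fields / bond functions) be finite-dimensional inner-product spaces, D : V → W linear (the gradient ∂ of the chart), N ≤ V ANY subspace
of «restricted» parameters (print: N(Q′) = {λ : (R₀u)ʲ-averages trivial on Λ_j, j = 0, …, k} — for ANY domain sequence {Ω_j}, in particular
the nested cubes {□_j} of (1.131) behind Prop. 6) such that no non-zero restricted parameter is D-closed (`N ⊓ ker D = ⊥`; on a torus at
U₀ = 1: ker ∂ = constants and a constant with vanishing block averages is 0 — `restricted_landau_unique`), Δ := D†D and R := the orthogonal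
projection onto Δ(N).  THEN for every T ∈ V (T = ∂ᴴA′) there is EXACTLY ONE λ ∈ N with R(T + Δλ) = 0 — existence λ = −λ₀ where
RT = Δλ₀ ∈ Δ(N); uniqueness since Δλ₁ = Δλ₂ forces ⟪D(λ₁−λ₂), D(λ₁−λ₂)⟫ = 0.  So the ∃!-clause of Theorems 2/4 at background 1 (all that
Sect. F / Prop. 6 uses of them besides the bounds, p. 99 «the assumptions of Theorem 4 are satisfied for the pair of configurations 1, U″₀»)
holds in the linear chart for EVERY admissible {Ω_j}, with no smallness condition; §§1–2 above are the one-level torus instance with the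
cell՚s concrete `RT`.  (Mathlib: `Submodule.starProjection`; honest scope: pure linear algebra, no estimate; the multi-level BOUNDS of
(1.36)/(1.62) need the no-external-field multi-domain propagators of [B5/B6] and are NOT touched.)
[cite: Balaban1985RegularSpaces, Thm 4 p.88 («exactly one gauge transformation u satisfying (1.29) and … (1.38)»), Thm 2 p.83, (1.27) p.80,
p.99 L8–10; Balaban1984PropagatorsI, p.25; Balaban1985BackgroundPropagators, (3.21) p.394] -/
theorem existsUnique_restricted_landau_abstract (D : V →ₗ[𝕜] W) (N : Submodule 𝕜 V)
    (hN : N ⊓ LinearMap.ker D = ⊥) (T : V) :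
    ∃! lam : N, (N.map (LinearMap.adjoint D ∘ₗ D)).starProjection
        (T + (LinearMap.adjoint D ∘ₗ D) (lam : V)) = 0 := by
  set Δ : V →ₗ[𝕜] V := LinearMap.adjoint D ∘ₗ D with hΔ
  set K : Submodule 𝕜 V := N.map Δ with hK
  have hmemK : ∀ lam : N, Δ (lam : V) ∈ K := fun lam => Submodule.mem_map_of_mem lam.2
  have hfix : ∀ v ∈ K, K.starProjection v = v := fun v hv => Submodule.starProjection_eq_self_iff.mpr hv
  have hRT : K.starProjection T ∈ K := Submodule.starProjection_apply_mem K T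
  -- existence: `RT = Δλ₀` with `λ₀ ∈ N`; take `λ = −λ₀`
  obtain ⟨lam₀, hlam₀N, hlam₀⟩ := (Submodule.mem_map).mp hRT
  refine ⟨⟨-lam₀, N.neg_mem hlam₀N⟩, ?_, ?_⟩
  · show K.starProjection (T + Δ (-lam₀)) = 0
    rw [map_neg, map_add, map_neg, hlam₀, hfix _ hRT, add_neg_cancel]
  · intro lam hlam
    have h1 : K.starProjection T + Δ (lam : V) = 0 := by
      have := hlam
      rw [map_add, hfix _ (hmemK lam)] at this
      exact this
    -- `Δ(λ − (−λ₀)) = 0`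
    have h2 : Δ ((lam : V) - (-lam₀)) = 0 := by
      rw [map_sub, map_neg, hlam₀]
      have := h1
      rw [add_comm] at this
      have e : Δ (lam : V) = -K.starProjection T := eq_neg_of_add_eq_zero_left this
      rw [e]; simp
    -- hence `D(λ − (−λ₀)) = 0` (positivity of `D†D`)
    have h3 : D ((lam : V) - (-lam₀)) = 0 := by
      set x : V := (lam : V) - (-lam₀)
      have hinner : ⟪D x, D x⟫_𝕜 = 0 := by
        rw [← LinearMap.adjoint_inner_right, ← LinearMap.comp_apply, ← hΔ, h2, inner_zero_right]
      exact inner_self_eq_zero.mp hinner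
    -- and a restricted D-closed parameter vanishes
    have h4 : (lam : V) - (-lam₀) ∈ N ⊓ LinearMap.ker D :=
      ⟨N.sub_mem lam.2 (N.neg_mem hlam₀N), LinearMap.mem_ker.mpr h3⟩
    rw [hN, Submodule.mem_bot, sub_eq_zero] at h4
    exact Subtype.ext h4

end Abstract

/-! ## §6 (v1.2, r05 gen 18) The unique restricted parameter is «−G′RT»: bridge to [4] (3.22)/(3.25) (`B9Eq325Proj`) -/

section Bridge325

open B9Eq325Proj (lapA lapKer R325 lam0 Data lapA_eq_of_ker)

variable {E F W : Type*} [NormedAddCommGroup E] [InnerProductSpace ℝ E] [FiniteDimensional ℝ E]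
  [NormedAddCommGroup F] [InnerProductSpace ℝ F]
  [NormedAddCommGroup W] [InnerProductSpace ℝ W] [FiniteDimensional ℝ W]
  (D : E →ₗ[ℝ] W) {q : E →ₗ[ℝ] F} {qs : F →ₗ[ℝ] E} {A : F →ₗ[ℝ] F} {g : E →ₗ[ℝ] E} {c : F →ₗ[ℝ] F}

/-- **The hypothesis `N ⊓ ker D = ⊥` of §5 FROM PRINT՚S INPUTS.**  p. 91 (after (1.90)): «If it was equal to Q′λ, then D*Dλ = Δλ
would belong to the subspace R = ΔN(Q′) and we would have Rg(iad_λ)Δλ = RΔλ + O(α₄)Δλ = (Δ + Q′*aQ′)λ + O(α₄)Δλ. Thus the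
main linear part in λ of the left-hand side of (1.90) would be given by the invertible operator, the remaining terms being
small.» — the invertible operator being G′⁻¹ = Δ + Q′*aQ′ of (1.91) («They were investigated in [4]»: [4] (3.24) Δ′_a,
p. 394 «Its inverse is denoted by G′», Theorem 3.11 p. 416 «positive definite»).  In the typed inputs of [4] pp. 393–394
(`B9Eq325Proj.Data Δ Q′ Q′* a G′ (Q′G′²Q′*)⁻¹`, G′ a two-sided inverse of Δ′_a) with Δ = D†D: a restricted (Q′λ = 0)
parameter with Dλ = 0 has Δ′_aλ = Δλ = 0 (`lapA_eq_of_ker`), hence λ = G′Δ′_aλ = 0.  So §5՚s `hN` holds for EVERY domain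
sequence for which print՚s G′(U₀) exists — at any background U₀, for the LINEAR part of (1.90).
[cite: Balaban1985RegularSpaces, p.91 (the paragraph between (1.90) and (1.91)) + (1.91); Balaban1985BackgroundPropagators, (3.24) p.394, Thm 3.11 p.416] -/
theorem ker_inf_ker_eq_bot_of_data (h : Data (LinearMap.adjoint D ∘ₗ D) q qs A g c) :
    LinearMap.ker q ⊓ LinearMap.ker D = ⊥ := by
  refine (Submodule.eq_bot_iff _).mpr ?_
  intro x hx
  obtain ⟨hq, hD⟩ := Submodule.mem_inf.mp hx
  rw [LinearMap.mem_ker] at hq hD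
  have h0 : lapA (LinearMap.adjoint D ∘ₗ D) q qs A x = 0 := by
    rw [lapA_eq_of_ker (LinearMap.adjoint D ∘ₗ D) q qs A x hq, LinearMap.comp_apply, hD, map_zero]
  have := h.g_left x
  rw [h0, map_zero] at this
  exact this.symm

/-- **THE EXPLICIT SOLUTION «λ = −G′RT».**  With λ₀ := G′RT (`B9Eq325Proj.lam0` = [4] (3.22) «Rf = Δ^η_U λ₀», [B5] (1.43)):
Q′λ₀ = 0 (`Data.q_lam0`) and R(T + Δ(−λ₀)) = RT − RΔλ₀ = RT − R(RT) = 0 — print՚s «RΔλ = Δλ» on N(Q′) (p. 91 display) and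
R² = R; here R is the orthogonal projection onto ΔN(Q′) (`lapKer`), which EQUALS the (3.25) operator
(`Data.R325_eq_starProjection_fd`). [cite: Balaban1985RegularSpaces, p.91 (between (1.90) and (1.91)); Balaban1985BackgroundPropagators,
(3.22)+(3.25) p.394; Balaban1984PropagatorsI, (1.43) p.25] -/
theorem neg_lam0_solves (h : Data (LinearMap.adjoint D ∘ₗ D) q qs A g c) (T : E) :
    q (lam0 q qs g c T) = 0 ∧
      (lapKer (LinearMap.adjoint D ∘ₗ D) q).starProjection
        (T + (LinearMap.adjoint D ∘ₗ D) (-(lam0 q qs g c T))) = 0 := by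
  refine ⟨h.q_lam0 T, ?_⟩
  rw [h.R325_eq_starProjection_fd, map_neg, map_add, map_neg, ← h.R325_eq_lap_lam0, h.R325_idem, add_neg_cancel]

/-- **«EXACTLY ONE» ON [4]՚S DATA.**  For every background datum of [4] pp. 393–394 with Δ = D†D and every T (= D*A′ in
(1.90)): there is exactly one λ with Q′λ = 0 and R(T + Δλ) = 0 — §5՚s `existsUnique_restricted_landau_abstract` with
N = N(Q′), its hypothesis discharged by `ker_inf_ker_eq_bot_of_data`.  This is the ∃!-clause of Theorems 2/4 for the
LINEAR problem «RΔλ + RT = 0, Q′λ = 0» at an arbitrary background and domain sequence (print p. 91: the nonlinear (1.90)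
differs from it by terms «of second order in α₃, α₄», handled by Sects. D–E — NOT here).
[cite: Balaban1985RegularSpaces, Thm 4 p.88, (1.90) + p.91 (between (1.90) and (1.91)); Balaban1985BackgroundPropagators, (3.21)–(3.25) p.394] -/
theorem existsUnique_restricted_landau_325 (h : Data (LinearMap.adjoint D ∘ₗ D) q qs A g c) (T : E) :
    ∃! lam : LinearMap.ker q, (lapKer (LinearMap.adjoint D ∘ₗ D) q).starProjection
        (T + (LinearMap.adjoint D ∘ₗ D) (lam : E)) = 0 :=
  existsUnique_restricted_landau_abstract D (LinearMap.ker q) (ker_inf_ker_eq_bot_of_data D h) T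

/-- **UNIQUENESS WITH THE FORMULA**: any restricted solution equals −G′RT. [cite: Balaban1985RegularSpaces, Thm 4 p.88 («exactly
one»), p.91 (between (1.90) and (1.91)); Balaban1985BackgroundPropagators, (3.22)+(3.25) p.394] -/
theorem restricted_landau_eq_neg_lam0 (h : Data (LinearMap.adjoint D ∘ₗ D) q qs A g c) (T lam : E)
    (hq : q lam = 0)
    (hR : (lapKer (LinearMap.adjoint D ∘ₗ D) q).starProjection (T + (LinearMap.adjoint D ∘ₗ D) lam) = 0) :
    lam = -(lam0 q qs g c T) := by
  obtain ⟨μ, -, huniq⟩ := existsUnique_restricted_landau_325 D h T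
  have h1 := huniq ⟨lam, LinearMap.mem_ker.mpr hq⟩ hR
  have h2 := huniq ⟨-(lam0 q qs g c T), (LinearMap.ker q).neg_mem (LinearMap.mem_ker.mpr (h.q_lam0 T))⟩
    (neg_lam0_solves D h T).2
  exact congrArg Subtype.val (h1.trans h2.symm)

/-- **IN PRINT՚S OWN LETTERS** (R = the (3.25) operator `R325` = I − G′Q′*(Q′G′²Q′*)⁻¹Q′G′): for Q′λ = 0,
R(T + Δλ) = 0 ↔ λ = −G′RT. [cite: Balaban1985RegularSpaces, Thm 4 p.88, p.91 (between (1.90) and (1.91)), (1.91); Balaban1985BackgroundPropagators,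
(3.25) p.394] -/
theorem R325_landau_iff (h : Data (LinearMap.adjoint D ∘ₗ D) q qs A g c) (T lam : E) (hq : q lam = 0) :
    R325 q qs g c (T + (LinearMap.adjoint D ∘ₗ D) lam) = 0 ↔ lam = -(lam0 q qs g c T) := by
  constructor
  · intro hR
    refine restricted_landau_eq_neg_lam0 D h T lam hq ?_
    rw [h.R325_eq_starProjection_fd]; exact hR
  · rintro rfl
    rw [← h.R325_eq_starProjection_fd]; exact (neg_lam0_solves D h T).2

end Bridge325

/-! ## §7 (v1.3, r05 gen 18) The concrete multi-domain instance at an ARBITRARY background: [4]՚s lattice systems (`B9Thm311Lattice`) -/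

section Lattice311

open B9Thm311Lattice (IsBlockSystem qL DL lapL AL obvious_311_lattice)
open B9Eq325Proj (lapKer R325 lam0 Data)

variable {X Y V : Type*} [Fintype X] [Fintype Y] [NormedAddCommGroup V] [InnerProductSpace ℝ V]
  [FiniteDimensional ℝ V]

/-- **«EXACTLY ONE» FOR THE LINEAR RESTRICTED LANDAU PROBLEM ON EVERY LATTICE SYSTEM OF [4], AT EVERY BACKGROUND.**  Finite
lattice X with bond set `bonds` and bond weights c_b > 0; 𝔤-valued site functions (V any finite-dimensional real inner-product
space); background transporters τ(x, x′) = R(U(x, x′)) injective ([4] p. 390 «R(U)X = UXU⁻¹»); ANY block system 𝔅 (blocks B(c),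
contours Γ_{c,x}, weights) with the printed structural properties `B9Thm311Lattice.IsBlockSystem` ([4] (3.18)–(3.19) p. 393; the
multi-level cube geometry 𝔅 = ⋃_j Λ_j of a domain sequence placed inside T_η has them by p40՚s
`B9Eq318EmbeddedLevels.isBlockSystem_levels_embed`).  THEN for every T ∈ L²(X, 𝔤) there is EXACTLY ONE λ with Q′(U)λ = 0 and
R(U)(T + Δ_U λ) = 0, where Δ_U = D_U†D_U ((3.23), `lapL`) and R(U) = the orthogonal projection onto Δ_U N(Q′(U)) ((3.21), `lapKer`).
Proof: [4] Theorem 3.11 on the lattice system — r06՚s `B9Thm311Lattice.obvious_311_lattice` (G′ = (Δ_U + Q′*aQ′)⁻¹ and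
(Q′G′²Q′*)⁻¹ exist, any a_c > 0) — feeds §6 (`existsUnique_restricted_landau_325`; R does not depend on a).  This is the LINEAR
problem «RΔλ + (source) = 0, Q′λ = 0» that p. 91 isolates inside (1.90) («would be given by the invertible operator») for a
GENERAL regular background and a GENERAL domain sequence — the algebraic core of Theorem 4՚s «exactly one»; the nonlinear terms
of (1.90) («the error is of second order in α₃, α₄», Sects. D–E) and every BOUND ((1.62), (1.92)) are NOT touched here.
[cite: Balaban1985RegularSpaces, Thm 4 p.88, (1.90)–(1.91) p.91; Balaban1985BackgroundPropagators, (3.19) p.393, (3.21)–(3.25) p.394,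
Thm 3.11 p.416] -/
theorem existsUnique_restricted_landau_lattice (τ : X → X → V →ₗ[ℝ] V)
    (hinj : ∀ x x' : X, Function.Injective (τ x x')) {bonds : Finset (X × X)} (cb : X × X → ℝ)
    (hcb : ∀ b ∈ bonds, 0 < cb b) {w : Y → X → ℝ} {B : Y → Finset X} {Γ : Y → X → List X} {y : Y → X}
    (hS : IsBlockSystem bonds w B Γ y) (T : PiLp 2 (fun _ : X => V)) :
    ∃! lam : LinearMap.ker (qL τ w B Γ y),
      (lapKer (lapL τ bonds cb) (qL τ w B Γ y)).starProjection
        (T + lapL τ bonds cb (lam : PiLp 2 (fun _ : X => V))) = 0 := by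
  obtain ⟨g, c, hdata, -⟩ := obvious_311_lattice τ hinj cb hcb hS (fun _ => 1) (fun _ => one_pos)
  exact existsUnique_restricted_landau_325 (DL τ bonds cb) hdata T

/-- **THE SAME WITH PRINT՚S FORMULA**: for ANY printed datum (G′, (Q′G′²Q′*)⁻¹) of the lattice system (`B9Eq325Proj.Data` for
`lapL`/`qL`/`AL a`, level weights a arbitrary — `obvious_311_lattice` provides one for every a_c > 0) and Q′(U)λ = 0:
R(T + Δ_Uλ) = 0 ↔ λ = −G′RT, with R = I − G′Q′*(Q′G′²Q′*)⁻¹Q′G′ the (3.25) operator (`R325`) and G′R = `lam0` ([4] (3.22)).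
[cite: Balaban1985RegularSpaces, Thm 4 p.88, p.91, (1.91); Balaban1985BackgroundPropagators, (3.22)+(3.25) p.394, Thm 3.11 p.416] -/
theorem R325_landau_iff_lattice (τ : X → X → V →ₗ[ℝ] V) {bonds : Finset (X × X)} (cb : X × X → ℝ)
    {w : Y → X → ℝ} {B : Y → Finset X} {Γ : Y → X → List X} {y : Y → X} {a : Y → ℝ}
    {g : PiLp 2 (fun _ : X => V) →ₗ[ℝ] PiLp 2 (fun _ : X => V)}
    {c : PiLp 2 (fun _ : Y => V) →ₗ[ℝ] PiLp 2 (fun _ : Y => V)}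
    (hdata : Data (lapL τ bonds cb) (qL τ w B Γ y) (LinearMap.adjoint (qL τ w B Γ y)) (AL a) g c)
    (T lam : PiLp 2 (fun _ : X => V)) (hq : qL τ w B Γ y lam = 0) :
    R325 (qL τ w B Γ y) (LinearMap.adjoint (qL τ w B Γ y)) g c (T + lapL τ bonds cb lam) = 0 ↔
      lam = -(lam0 (qL τ w B Γ y) (LinearMap.adjoint (qL τ w B Γ y)) g c T) :=
  R325_landau_iff (DL τ bonds cb) hdata T lam hq

end Lattice311

end Literature.MathematicalPhysics.QuantumFieldTheory.Balaban1983to89.B8Thm4FlatTorus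

end
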